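import Mathlib.GroupTheory.SpecificGroups.Quaternion
import Literature.Combinatorics.Additive.TripleProductProperty
import HarnessLib

/-!
# `Q₁₆`: no TPP triple of normalised shape `(1,1 | 1,2 | 1,2)` (finite check)

ω-census, family (b3).  Framing: lottery ticket; floor = certified bounds/negative ranges.

The kernel-`decide` half of `β(Q₁₆) = 16` (`Quaternion16Law.lean`): in `Q₁₆ = QuaternionGroup 4` no triple
`S = {1, xa s}`, `T = {1, xa t, xa t'}`, `U = {1, xa u, xa u'}` (`t < t'`, `u < u'` in `ℤ₈`; `8 · 28 · 28 = 6 272` triples)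
has the triple product property.  Kept in its own file (light imports) so that the `Decidable` instance found for the
written-out TPP is the structural one.
-/

namespace Summit.MatrixMultiplication.OmegaCensus

open Literature.Combinatorics.Additive

set_option synthInstance.maxSize 2048 in
set_option synthInstance.maxHeartbeats 400000 in
-- the `Decidable` instance for the unfolded TPP over five `ZMod 8` binders is deep (not expensive): raise the search size
/-- **No normalised `(1,1 | 1,2 | 1,2)` TPP triple in `Q₁₆`** (`decide`, 6 272 triples). [folklore] -/
theorem q16_no_tpp_112_fc :
    ∀ s t t' u u' : ZMod 8, t.val < t'.val → u.val < u'.val →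
      ¬ TripleProductProperty
        ({QuaternionGroup.a 0, QuaternionGroup.xa s} : Finset (QuaternionGroup 4))
        ({QuaternionGroup.a 0, QuaternionGroup.xa t, QuaternionGroup.xa t'} : Finset (QuaternionGroup 4))
        ({QuaternionGroup.a 0, QuaternionGroup.xa u, QuaternionGroup.xa u'} : Finset (QuaternionGroup 4)) := by
  unfold TripleProductProperty; decide +kernel

end Summit.MatrixMultiplication.OmegaCensus
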